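import Summits.ValiantsHypothesis.ValiantsHypothesis.Theorems.TwoProducts.RankThreeWronskianTower

/-!
# Rung 3-AFF, located cell T1-B (ONE SPARSE CARRIER), part 1: the FREE-DEGREE rank-two corollary and the COLLINEAR cell

T1-B (val-idea-crit-8 g4 price list 2026-08-29T06:03:38Z): `P(u, w₁, w₂)` with `P : Poly3` of total degree `≤ m` (NOT homogeneous),
`u` `t`-sparse and `w₁, w₂` MONOMIAL letters (`≤ 1` monomial each).  This file records the two pieces of T1-B that the rank-two
Jacobian tower already decides:

* ★ `rankTwo_freeDeg_bound` — the tower induction ✓ `tower` (`RankTwoJacobianTowerInduction`) bounds `|Eset|` by the degree of `P` in the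
  `w₂`-slot ONLY, so the crude rank-two bound holds with `m` = the `X₁`-degree of `P` and NO hypothesis on its `X₀`-degree:
  `nv (P(w₁,w₂)) ≤ 2(m+1)(3(t₁²+t₁) + 2 + (t₁t₂)²) + 4` for `w₁` non-constant `t₁`-sparse and `w₂` `t₂`-sparse
  (a bookkeeping corollary of val-idea-35 g9's tower; the two sparsities are kept separate because T1-B uses `t₁ = 1`).
* ★ `oneSparse_collinear_nv_le` — the COLLINEAR cell of T1-B: if the two monomial letters are powers `c₁X^{aγ}`, `c₂X^{bγ}` of one
  monomial `X^γ` (`γ ≠ 0`), then `P(u, c₁X^{aγ}, c₂X^{bγ}) = P′(X^γ, u)` with `deg_U P′ ≤ m` (the `X^γ`-degree of `P′` is `≤ m·max(a,b)`,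
  uncontrolled — which is exactly why the free-degree form is needed), hence `nv ≤ 2(m+1)(t²+8) + 4`, uniformly in `a, b, γ, c₁, c₂`.
  (`P′` is written out as a `Finset.sum` of monomials — no new definition; `aeval_reindexCollinear` is the evaluation identity, `deg1_reindexCollinear`
  the slot degree; `oneSparseCollinearLaw` the law currency `(m+2)⁴(t+2)⁴`.)
* `oneSparse_constants_nv_le` — both monomial letters constant: `nv ≤ 2(m+1)(t⁴+3t²+3t+2) + 4` (✓ `rankTwoCrudeBound`).

What is NOT here (the content of T1-B): two NON-collinear monomial letters `X^α, X^β`.  On an arc with pivot `p` of `u` the fibres of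
`(i,j,k) ↦ i p + j α + k β` are singletons unless `det(aα + bβ, p) = 0` for some `0 < |a|,|b| ≤ m` (RESONANT pivot); the resonant pivots are
val-idea-35 g11's residue R1 restricted to this class and stay OPEN.
HONEST LABEL: helper / located sub-cell of the OPEN rung 3-AFF of the SIDE ladder «table-rank-ladder» (K13) of crux `stmt-ValiantsHypothesis-5906`
(`TwoProducts`); NOT γ; `RankThreeAffineLaw(Exp)` / `TwoProducts` / PCB / `ResidualLawV25` UNMOVED; 0 summit distance; VP ≠ VNP is NOT proved.
`--supports stmt-ValiantsHypothesis-5906 --as helper`.  No instances, no notation, no named facts. [folklore]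
-/

noncomputable section
set_option linter.dupNamespace false

namespace Summit.ValiantsHypothesis.ValiantsHypothesis.Theorems.TwoProducts.RankTwoJacobian

open scoped BigOperators Pointwise Classical
open MvPolynomial

/-! ### The free-degree rank-two bound -/

/-- ★ FREE-DEGREE RANK-TWO BOUND: for `w₁` NON-CONSTANT with `≤ t₁` monomials, `w₂` with `≤ t₂` monomials and `P : Poly2` whose
degree IN THE SECOND VARIABLE is `≤ m` (its degree in the first variable is free),
`nv (P(w₁,w₂)) ≤ 2·(m+1)·(3(t₁²+t₁) + 2 + (t₁t₂)²) + 4`.  (✓ `tower` twice + ✓ `nv_le`; the kernel lemmas ✓ `axialTransfer`,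
✓ `chainRule`, ✓ `ostrowski`, ✓ `card_support_jac_le` instantiate the abstract tower.) -/
theorem rankTwo_freeDeg_bound (m t₁ t₂ : ℕ) (P w₁ w₂ : Poly2) (hS : (S1 w₁).Nonempty)
    (hdeg : ∀ s ∈ P.support, s 1 ≤ m) (h1 : w₁.support.card ≤ t₁) (h2 : w₂.support.card ≤ t₂) :
    nv (aeval ![w₁, w₂] P) ≤ 2 * ((m + 1) * (3 * (t₁ * t₁ + t₁) + 2 + (t₁ * t₂) * (t₁ * t₂))) + 4 := by
  set J := jac w₂ w₁ with hJdef
  have hdeg' : ∀ s ∈ P.support, s 1 < m + 1 := fun s hs => Nat.lt_succ_of_le (hdeg s hs)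
  have hX : ∀ σ : ℝ, (Xc σ w₁).card ≤ t₁ * t₁ + t₁ :=
    fun σ => (card_Xc_le σ w₁).trans (Nat.add_le_add (Nat.mul_le_mul h1 h1) h1)
  have hJ : J.support.card ≤ t₁ * t₂ := by
    rw [hJdef, mul_comm]
    exact (card_support_jac_le w₂ w₁).trans (Nat.mul_le_mul h2 h1)
  have hEJ : ∀ σ : ℝ, (Eset σ J).card ≤ (t₁ * t₂) * (t₁ * t₂) :=
    fun σ => (card_Eset_le σ J).trans (Nat.mul_le_mul hJ hJ)
  have hAT : ∀ (ν : Fin 2 → ℝ) (F : Poly2) (e : Expo), F ≠ 0 → IsAxialLead ν w₁ e → IsEdgeDir ν F →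
      IsSpecial ν F e ∨ IsEdgeDir ν (jac F w₁) := fun ν F e => axialTransfer ν F w₁ e
  have hCR : ∀ Q : Poly2, jac (aeval ![w₁, w₂] Q) w₁ = aeval ![w₁, w₂] (pderiv 1 Q) * J :=
    fun Q => chainRule Q w₁ w₂
  have T1 := tower (σ := 1) (Or.inl rfl) w₁ w₂ J (fun F => jac F w₁) hAT hCR ostrowski hS (m + 1) P hdeg'
  have T2 := tower (σ := -1) (Or.inr rfl) w₁ w₂ J (fun F => jac F w₁) hAT hCR ostrowski hS (m + 1) P hdeg'
  have hn := nv_le (aeval ![w₁, w₂] P)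
  have K1 : 3 * (Xc 1 w₁).card + 2 + (Eset 1 J).card ≤ 3 * (t₁ * t₁ + t₁) + 2 + (t₁ * t₂) * (t₁ * t₂) := by
    have := hX 1; have := hEJ 1; omega
  have K2 : 3 * (Xc (-1) w₁).card + 2 + (Eset (-1) J).card ≤ 3 * (t₁ * t₁ + t₁) + 2 + (t₁ * t₂) * (t₁ * t₂) := by
    have := hX (-1); have := hEJ (-1); omega
  have b1 := T1.trans (Nat.mul_le_mul_left (m + 1) K1)
  have b2 := T2.trans (Nat.mul_le_mul_left (m + 1) K2)
  omega

/-- A non-zero monomial `X^γ` (`γ ≠ 0`) is a non-constant letter: `S1 (monomial γ 1)` is nonempty. -/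
theorem S1_monomial_nonempty {γ : Expo} (hγ : γ ≠ 0) : (S1 (monomial γ (1 : ℂ) : Poly2)).Nonempty :=
  ⟨γ, mem_S1.mpr ⟨by rw [support_monomial, if_neg one_ne_zero]; exact Finset.mem_singleton_self _, hγ⟩⟩

/-- The monomial letter `X^γ` has exactly one monomial. -/
theorem card_support_monomial_le (γ : Expo) (c : ℂ) : ((monomial γ c : Poly2)).support.card ≤ 1 :=
  (Finset.card_le_card (support_monomial_subset)).trans (by simp)

/-- ★ FREE-DEGREE BOUND WITH A MONOMIAL FIRST LETTER: `nv (P(X^γ, u)) ≤ 2(m+1)(t²+8) + 4` whenever `γ ≠ 0`, `u` has `≤ t` monomials and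
`P` has degree `≤ m` in its SECOND variable (no hypothesis on the `X^γ`-degree). -/
theorem monomialLetter_freeDeg_bound (m t : ℕ) (P u : Poly2) {γ : Expo} (hγ : γ ≠ 0)
    (hdeg : ∀ s ∈ P.support, s 1 ≤ m) (hu : u.support.card ≤ t) :
    nv (aeval ![(monomial γ (1 : ℂ) : Poly2), u] P) ≤ 2 * ((m + 1) * (t * t + 8)) + 4 := by
  have h := rankTwo_freeDeg_bound m 1 t P (monomial γ 1) u (S1_monomial_nonempty hγ) hdeg
    (card_support_monomial_le γ 1) hu
  have e : 3 * (1 * 1 + 1) + 2 + (1 * t) * (1 * t) = t * t + 8 := by ring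
  rw [e] at h
  exact h

/-! ### The collinear cell of T1-B -/

/-- The reindexed outer polynomial `P′(V, U) := Σ_d P_d · c₁^{d₁} c₂^{d₂} · V^{a d₁ + b d₂} U^{d₀}` (variable `0` = `V`, variable `1` = `U`;
written out as a `Finset.sum`, no new definition) has `U`-degree at most `totalDegree P`. -/
theorem deg1_reindexCollinear (P : Poly3) (a b : ℕ) (c₁ c₂ : ℂ) :
    ∀ s ∈ (∑ d ∈ P.support, monomial (Finsupp.single 0 (a * d 1 + b * d 2) + Finsupp.single 1 (d 0))
      (coeff d P * c₁ ^ (d 1) * c₂ ^ (d 2)) : Poly2).support, s 1 ≤ P.totalDegree := by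
  intro s hs
  obtain ⟨d, hd, hsd⟩ := Finset.mem_biUnion.mp (support_sum hs)
  have hs' := support_monomial_subset hsd
  rw [Finset.mem_singleton] at hs'
  subst hs'
  rw [Finsupp.add_apply, Finsupp.single_apply, Finsupp.single_apply, if_neg (by decide), if_pos rfl, zero_add]
  calc d 0 ≤ d.sum (fun _ e => e) := by
        rw [Finsupp.sum]
        by_cases h0 : (0 : Fin 3) ∈ d.support
        · exact Finset.single_le_sum (fun _ _ => Nat.zero_le _) h0
        · rw [Finsupp.notMem_support_iff.mp h0]; exact Nat.zero_le _
    _ ≤ P.totalDegree := le_totalDegree hd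

/-- EVALUATION IDENTITY: `P′(X^γ, u) = P(u, c₁X^{aγ}, c₂X^{bγ})`. -/
theorem aeval_reindexCollinear (P : Poly3) (u : Poly2) (γ : Expo) (a b : ℕ) (c₁ c₂ : ℂ) :
    aeval ![(monomial γ (1 : ℂ) : Poly2), u]
      (∑ d ∈ P.support, monomial (Finsupp.single 0 (a * d 1 + b * d 2) + Finsupp.single 1 (d 0))
        (coeff d P * c₁ ^ (d 1) * c₂ ^ (d 2)) : Poly2) =
      aeval ![u, monomial (a • γ) c₁, monomial (b • γ) c₂] P := by
  conv_rhs => rw [P.as_sum]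
  rw [map_sum, map_sum]
  refine Finset.sum_congr rfl fun d _ => ?_
  rw [aeval_monomial, aeval_monomial, Finsupp.prod_add_index', Finsupp.prod_single_index, Finsupp.prod_single_index]
  · simp only [MvPolynomial.algebraMap_eq, Matrix.cons_val_zero, Matrix.cons_val_one]
    rw [Finsupp.prod_fintype _ _ (fun i => by exact pow_zero _)]
    simp only [Fin.prod_univ_three, Matrix.cons_val_zero, Matrix.cons_val_one, Matrix.cons_val]
    rw [monomial_pow, monomial_pow, monomial_pow, one_pow, map_mul, map_mul]
    have hm : (monomial ((a * d 1 + b * d 2) • γ) (1 : ℂ) : Poly2) =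
        monomial (d 1 • (a • γ)) 1 * monomial (d 2 • (b • γ)) 1 := by
      rw [monomial_mul, one_mul, add_smul, smul_smul, smul_smul, mul_comm (d 1) a, mul_comm (d 2) b]
    rw [hm]
    have hc : (C (c₁ ^ d 1) : Poly2) * monomial (d 1 • (a • γ)) 1 = monomial (d 1 • (a • γ)) (c₁ ^ d 1) := by
      rw [C_mul_monomial, mul_one]
    have hc' : (C (c₂ ^ d 2) : Poly2) * monomial (d 2 • (b • γ)) 1 = monomial (d 2 • (b • γ)) (c₂ ^ d 2) := by
      rw [C_mul_monomial, mul_one]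
    rw [← hc, ← hc']
    ring
  · exact pow_zero _
  · exact pow_zero _
  · intro i; exact pow_zero _
  · intro i m n; exact pow_add _ _ _

/-- ★ THE COLLINEAR CELL OF T1-B: for `u` with `≤ t` monomials, `γ ≠ 0`, any `a b : ℕ`, `c₁ c₂ : ℂ` and `P : Poly3` of total degree `≤ m`,
`nv (P(u, c₁X^{aγ}, c₂X^{bγ})) ≤ 2(m+1)(t²+8) + 4` — uniformly in `a, b, γ, c₁, c₂` (a located sub-cell of the OPEN rung 3-AFF; the
NON-collinear monomial letters are NOT covered). -/
theorem oneSparse_collinear_nv_le (m t : ℕ) (P : Poly3) (u : Poly2) (hu : u.support.card ≤ t) {γ : Expo} (hγ : γ ≠ 0)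
    (a b : ℕ) (c₁ c₂ : ℂ) (hP : P.totalDegree ≤ m) :
    nv (aeval ![u, monomial (a • γ) c₁, monomial (b • γ) c₂] P) ≤ 2 * ((m + 1) * (t * t + 8)) + 4 := by
  rw [← aeval_reindexCollinear]
  exact monomialLetter_freeDeg_bound m t _ u hγ
    (fun s hs => (deg1_reindexCollinear P a b c₁ c₂ s hs).trans hP) hu

/-- Both monomial letters CONSTANT (the degenerate corner `a = b = 0` of the collinear cell, `C c = monomial (0 • γ) c` with `γ = (1,0)`):
`nv (P(u, c₁, c₂)) ≤ 2(m+1)(t²+8) + 4`. -/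
theorem oneSparse_constants_nv_le (m t : ℕ) (P : Poly3) (u : Poly2) (hu : u.support.card ≤ t) (c₁ c₂ : ℂ)
    (hP : P.totalDegree ≤ m) :
    nv (aeval ![u, C c₁, C c₂] P) ≤ 2 * ((m + 1) * (t * t + 8)) + 4 := by
  have hγ : (Finsupp.single (0 : Fin 2) 1 : Expo) ≠ 0 := by
    intro h
    have := congrArg (fun f : Expo => f 0) h
    simp at this
  have h := oneSparse_collinear_nv_le m t P u hu hγ 0 0 c₁ c₂ hP
  simp only [zero_smul, ← C_apply] at h ⊢
  exact h

/-! ### Law currency -/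

/-- the crude arithmetic `2(m+1)(t²+8) + 4 ≤ (m+2)⁴ (t+2)⁴`. [folklore] -/
theorem collinear_arith (m t : ℕ) : 2 * ((m + 1) * (t * t + 8)) + 4 ≤ (m + 2) ^ 4 * (t + 2) ^ 4 := by
  have h1 : 2 * ((m + 1) * (t * t + 8)) + 4 ≤ (m + 2) * (2 * (t * t) + 16) := by nlinarith
  have h2 : 2 * (t * t) + 16 ≤ (t + 2) ^ 4 := by
    have e : (t + 2) ^ 4 = (t ^ 4 + 8 * t ^ 3 + 22 * t ^ 2 + 32 * t) + (2 * (t * t) + 16) := by ring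
    rw [e]; exact Nat.le_add_left _ _
  have h3 : m + 2 ≤ (m + 2) ^ 4 := Nat.le_self_pow (by norm_num) _
  calc 2 * ((m + 1) * (t * t + 8)) + 4 ≤ (m + 2) * (2 * (t * t) + 16) := h1
    _ ≤ (m + 2) ^ 4 * (t + 2) ^ 4 := Nat.mul_le_mul h3 h2

/-- ★ THE COLLINEAR SUB-LAW OF T1-B, in law currency (`c = 4`): T1-B (val-idea-crit-8 g4's «one sparse carrier» law — `P : Poly3` of total
degree `≤ m`, one `t`-sparse letter, two MONOMIAL letters ⇒ `nv ≤ (m+2)^c (t+2)^c`, a typed OPEN onset, deliberately NOT restated as a `def`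
here) HOLDS on the sub-class where the two monomial letters are `c₁X^{aγ}`, `c₂X^{bγ}` for ONE exponent `γ ≠ 0`. -/
theorem oneSparseCollinearLaw : ∃ c : ℕ, ∀ (m t : ℕ) (P : Poly3) (u : Poly2) (γ : Expo) (a b : ℕ) (c₁ c₂ : ℂ),
    P.totalDegree ≤ m → u.support.card ≤ t → γ ≠ 0 →
    nv (MvPolynomial.aeval ![u, monomial (a • γ) c₁, monomial (b • γ) c₂] P) ≤ (m + 2) ^ c * (t + 2) ^ c :=
  ⟨4, fun m t P u _γ a b c₁ c₂ hP hu hγ => (oneSparse_collinear_nv_le m t P u hu hγ a b c₁ c₂ hP).trans (collinear_arith m t)⟩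

end Summit.ValiantsHypothesis.ValiantsHypothesis.Theorems.TwoProducts.RankTwoJacobian

end
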